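import Literature.Probability.RandomPlanarGeometry.RestrictionMeasuresFiveEighthsThreeLeaves
import HarnessLib

/-!
# The hung cloud makes `i` an INTERIOR point with positive probability, from any `P_1`; [LSW] p. 5 results 1–2 and Cor. 8.6 from the existence-only §7 leaves

Proof-only companion (no definition of a notion, no named fact) of `OneSidedExcursionCloudMeasure`
and `RestrictionMeasuresFiveEighthsThreeLeaves`, after

* G. F. Lawler, *Conformally Invariant Processes in the Plane*, AMS (2005) (**[Law05]**), §9.2
  Prop. 9.13 (p. 220: the left filling `K_λ` of a Poissonian realization of excursions hung on
  `(−∞, 0]` "has the distribution `P⁺_{cλ}`") and the proof of Cor. 9.11 (p. 219: "The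
  construction above shows that `q(α) ∈ (0, 1)`");
* G. F. Lawler, O. Schramm, W. Werner, *Conformal restriction: the chordal case*, J. Amer. Math.
  Soc. **16** (2003) 917–955, arXiv:math/0209343 (**[LSW]**), §2 p. 8 ("Fillings": `F^{ℝ₊}_ℍ(A)`
  is "the union of `A` with the connected components of `ℍ̄ ∖ A` which do not intersect
  `[0, ∞)`"), Prop. 8.1, Cor. 8.6 (pp. 37–38), p. 5 results 1–2, Thm. 7.3 (p. 29).

State of the tree. `OneSidedExcursionCloudMeasure` realizes `P⁺_β`, `β > 0`, as the left-filled
Poissonian cloud of samples of ANY two-sided restriction measure `P` of exponent `1` hung between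
pairs of points of `(−∞, 0)` (`ExcursionCloud.isRightRestrictionMeasure_map_cloudConfig`), and
proves `P'{i ∈ K⁺} > 0` (`ExcursionCloud.measure_I_mem_cloudConfig_pos`) under the EXTRA
hypothesis that `P`-a.e. sample has an interior point; through
`RestrictionMeasuresFiveEighthsThreeLeaves` this hypothesis is why [LSW] Cor. 8.6, Prop. 8.1,
p. 5 result 1 (`exists_isRestrictionMeasure_iff`) and p. 5 result 2 (`LawlerSchrammWerner2003`,
`IsRestrictionMeasure.eq_five_eighths_of_(outer_)simple`) currently rest on the interior-point
form `exists_isBrownianBubbleMeasure_ae_interior_nonempty` of the §7.1 leaf rather than on the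
bare existence `exists_isBrownianBubbleMeasure` of a Brownian bubble measure.

This file removes that hypothesis: **the left-filled cloud makes `i` an interior point with
positive probability for every `P_1` whatsoever** (`ExcursionCloud.measure_I_mem_interior_cloudConfig_pos`).
The filling does the work, not the samples: a sample `K ∈ Ω` hung by the Möbius map
`M = m_{x',y'}(a⁻¹ ·)` (feet `x' < y' < 0`, `M(0) = x'`, `M(∞) = y'`, `M((0, ∞)) = (x', y')`)
encloses, together with the segment `[x', y']` of the half-line `(−∞, 0]` the cloud hangs on,
the region `M(right domain of K)`; this region is open, and it lies in the left filling of the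
cloud (`ExcursionCloud.enclosed_subset_leftFilling`): a connected subset of `ℍ̄ ∖ cloud` joining
one of its points to a point `x₀ ≥ 0` would pull back under `M⁻¹` to a connected subset of
`ℍ̄ ∖ cl K` joining a point of the right domain of `K` to the NONPOSITIVE real `M⁻¹(x₀)`, which
the tree's crossing lemma forbids (`RestrictionConfig.subset_rightDomain_of_isPreconnected`,
`RestrictionConfig.ofReal_notMem_rightDomain`, file `RestrictionSides`). So `i` is interior to
the left-filled cloud as soon as some cloud point `((x, y), a, K)` has `a · m⁻¹(i)` in the right
domain of `K`; and `P{B ⊆ right domain of K} ≥ P{K ∩ A = ∅} = Φ'_A(0) > 0` for a `+`-hull `A`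
containing a disc `B` of the open left quadrant (`RestrictionConfig.subset_rightDomain_of_disjoint`;
`A` one of the covering hulls `coverHull n` of `OneSidedExcursionCloud`), while the parameters
with `a · m⁻¹(i) ∈ B` have positive intensity exactly as in `OneSidedExcursionCloudMeasure`.
Consequences (all PROVED, no new named fact):

* `ExcursionCloud.exists_isRightRestrictionMeasure_intPos_of_exists_one`,
  `IsRightRestrictionMeasure.measure_I_mem_interior_ne_zero_of_exists_one` — given ANY `P_1`,
  for every `β > 0` the (unique) `P⁺_β` gives `{i ∈ int K}` positive probability; in
  particular the small-`β` interior positivity `intPos` and the positivity `P⁺_β{i ∉ K} < 1`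
  consumed by the tree's one-sided reductions;
* hence **from the existence of a two-sided restriction measure of exponent `1` alone**: the
  Cor. 8.6 input (`exists_isRightRestrictionMeasure_lt_five_eighths_of_exists_one`), [LSW]
  Cor. 8.6 (`not_exists_isRestrictionMeasure_of_lt_five_eighths_of_exists_one`), p. 5 result 2
  in both readings (`IsRestrictionMeasure.eq_five_eighths_of_outer_simple_of_exists_one`,
  `IsRestrictionMeasure.eq_five_eighths_of_simple_of_exists_one`) and
  `LawlerSchrammWerner2003_of_exists_one`;
* hence **p. 5 result 1 is equivalent to its existence half above `5/8`**
  (`exists_isRestrictionMeasure_iff_iff_forall_gt`: the "only if" half, Cor. 8.6, follows from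
  the existence of `P_1`);
* hence all of the above **from the three EXISTENCE-ONLY §7 leaves** — a Brownian bubble
  measure (`exists_isBrownianBubbleMeasure`, §7.1 (7.1)–(7.2)), `Ξ(κ) ∈ Ω` almost surely
  (`SLEBubbles.ae_mem_restrictionConfigs`) and Theorem 6.5
  (`SLEBubbles.lintegral_poissonAvoidance_eq_rpow`) — through `P_1 = law of Ξ(2)`
  (`exists_isRestrictionMeasure_of_five_eighths_le_of_three_leaves`): the primed theorems
  `…_of_three_leaves'` below. The interior property of Brownian bubbles
  (`IsBrownianBubbleMeasure.ae_interior_nonempty`, bundled in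
  `exists_isBrownianBubbleMeasure_ae_interior_nonempty`) is thereby removed from the hypotheses
  of every statement of [LSW] p. 5 in the tree except the interior-point leaf
  `IsRestrictionMeasure.ae_interior_nonempty_of_gt_five_eighths` itself.

Mathlib: `connectedComponentIn_nonempty_iff`, `IsPreconnected.image`,
`ContinuousOn.isOpen_inter_preimage`, `interior_maximal`, `Real.rpow_pos_of_pos`.
Tree: `ExcursionCloud.*` (`OneSidedExcursionCloudMeasure`), `goodParams`, `hungSet`,
`coverHull`, `exists_closedBall_inter_subset_coverHull`, `exists_goodParams_eq`,
`continuous_hungPoint_I`, `paramMeasure_pos_of_isOpen` (`OneSidedExcursionCloud(Measure)`),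
`excInv`/`excMap` (`OneSidedExcursionHulls`), `RestrictionConfig.rightDomain` and its API
(`RestrictionSides`), `IsStarHull.exists_isRestrictionMap`,
`IsStarHull.exists_hasRestrictionDeriv_holds`, the reductions of
`RestrictionMeasuresFiveEighthsThreeLeaves` / `…OneSided` / `RestrictionMeasuresExistenceHolds`.

## References

* G. F. Lawler, *Conformally Invariant Processes in the Plane*, AMS (2005), §9.2 Prop. 9.13
  (p. 220), Cor. 9.11 (p. 219). [Lawler2005]
* [LSW] §2 p. 8 (Fillings), Prop. 8.1 (§8.2), Cor. 8.6 (pp. 37–38), p. 5 results 1–2, Thm. 7.3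
  (p. 29). [LawlerSchrammWerner2003Restriction]
-/

noncomputable section

open Set Filter Topology Complex MeasureTheory Metric
open UpperHalfPlane (upperHalfPlaneSet isOpen_upperHalfPlaneSet)
open Literature.Probability.Process (IsPoissonCloud exists_isPoissonCloud_holds)
open scoped ComplexConjugate ENNReal Pointwise

namespace Literature.Probability.RandomPlanarGeometry

/-! ### Avoidance probabilities are positive; a `+`-hull containing a disc of the left quadrant -/

/-- **`P_α[K ∩ A = ∅] = Φ'_A(0)^α > 0`** for every `A ∈ 𝒬*` (a restriction map of `A` exists,
`IsStarHull.exists_isRestrictionMap`, and `Φ'_A(0) ∈ (0, 1]`, [LSW] (2.4)).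
[cite: LawlerSchrammWerner2003Restriction, Def. 3.4 / Prop. 3.3 (3) (pp. 10–11) with (2.4) p. 7] -/
theorem IsRestrictionMeasure.measure_avoid_pos {α : ℝ} {P : Measure RestrictionConfig}
    (hP : IsRestrictionMeasure α P) {A : Set ℂ} (hA : IsStarHull A) :
    0 < P (RestrictionConfig.avoid A) := by
  obtain ⟨Φ, hΦ⟩ := hA.exists_isRestrictionMap
  obtain ⟨d, hd0, -, hd⟩ := IsStarHull.exists_hasRestrictionDeriv_holds hA hΦ
  rw [hP.2 hA hΦ hd]
  exact ENNReal.ofReal_pos.2 (Real.rpow_pos_of_pos hd0 α)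

/-- **A `+`-hull containing a disc of the open left quadrant**: the covering hull `A_n` of
`OneSidedExcursionCloud` through `z₀ = −1 + i` contains `B(z₀, r)` for small `r`. [folklore] -/
theorem exists_isPlusHull_ball_subset :
    ∃ (A : Set ℂ) (z₀ : ℂ) (r : ℝ), IsPlusHull A ∧ 0 < r ∧ z₀.re < 0 ∧ 0 < z₀.im ∧
      ball z₀ r ⊆ {z : ℂ | z.re < 0} ∧ ball z₀ r ⊆ A := by
  set z₀ : ℂ := -1 + Complex.I with hz₀
  have hz₀im : z₀.im = 1 := by simp [hz₀]
  have hz₀re : z₀.re = -1 := by simp [hz₀]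
  have hz₀n : z₀ ∉ nonposAxis := fun h ↦ by
    have := (mem_nonposAxis_iff.1 h).1
    rw [hz₀im] at this
    exact one_ne_zero this
  obtain ⟨n, r₁, hr₁, hsub⟩ := exists_closedBall_inter_subset_coverHull (z := z₀) (by rw [hz₀im]; norm_num) hz₀n
  refine ⟨coverHull n, z₀, min r₁ (1 / 2), isPlusHull_coverHull n, lt_min hr₁ (by norm_num),
    by rw [hz₀re]; norm_num, by rw [hz₀im]; norm_num, fun w hw ↦ ?_, fun w hw ↦ ?_⟩
  · rw [mem_ball, dist_eq_norm] at hw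
    have h1 : |(w - z₀).re| ≤ ‖w - z₀‖ := abs_re_le_norm _
    rw [Complex.sub_re, hz₀re, abs_le] at h1
    have h2 : ‖w - z₀‖ < 1 / 2 := lt_of_lt_of_le hw (min_le_right _ _)
    show w.re < 0
    linarith [h1.2]
  · refine hsub ⟨mem_closedBall.2 (le_of_lt (lt_of_lt_of_le (mem_ball.1 hw) (min_le_left _ _))), ?_⟩
    rw [mem_ball, dist_eq_norm] at hw
    have h1 : |(w - z₀).im| ≤ ‖w - z₀‖ := abs_im_le_norm _
    rw [Complex.sub_im, hz₀im, abs_le] at h1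
    have h2 : ‖w - z₀‖ < 1 / 2 := lt_of_lt_of_le hw (min_le_right _ _)
    show 0 < w.im
    linarith [h1.1]

namespace ExcursionCloud

/-! ### The region enclosed by a hung sample lies in the left-filled cloud -/

section Enclosed

/-! The hanging map of a cloud point `((x, y), a, K)` is `M = m_{x',y'}(a⁻¹ ·)` (`hungSet`); its
inverse on `ℍ` is the pull-back `w ↦ a · m_{x',y'}⁻¹(w) = a · excInv x' y' w`. -/

/-- The pull-back `w ↦ a · m_{x,y}⁻¹(w)` is continuous off the pole `y`. [folklore] -/
theorem continuousOn_mul_excInv (a x y : ℝ) {S : Set ℂ} (hS : (y : ℂ) ∉ S) :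
    ContinuousOn (fun w ↦ (a : ℂ) * excInv x y w) S :=
  continuousOn_const.mul (continuousOn_excInv (x := x) hS)

/-- The pull-back keeps the closed upper half-plane (`x < y`, `a > 0`). [folklore] -/
theorem mul_excInv_im_nonneg {a x y : ℝ} (hxy : x < y) (ha : 0 < a) {w : ℂ} (hw : 0 ≤ w.im) :
    0 ≤ ((a : ℂ) * excInv x y w).im := by
  rw [Complex.mul_im, Complex.ofReal_re, Complex.ofReal_im, zero_mul, add_zero, excInv_im]
  exact mul_nonneg ha.le (div_nonneg (mul_nonneg (by linarith) hw) (Complex.normSq_nonneg _))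

/-- The pull-back of a real point is real: `a (x − t)/(t − y)`. [folklore] -/
theorem mul_excInv_ofReal (a x y t : ℝ) :
    (a : ℂ) * excInv x y (t : ℂ) = ((a * ((x - t) / (t - y)) : ℝ) : ℂ) := by
  rw [excInv]
  push_cast
  ring

/-- The pull-back of a point of `[0, ∞)` is a point of `(−∞, 0]` when the feet are negative and
`a > 0` (`x − t < 0 < t − y`). [folklore] -/
theorem mul_excInv_ofReal_nonpos {a x y t : ℝ} (hx : x < 0) (hy : y < 0) (ha : 0 < a) (ht : 0 ≤ t) :
    a * ((x - t) / (t - y)) ≤ 0 := by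
  have hnum : x - t < 0 := by linarith
  have hden : 0 < t - y := by linarith
  exact (mul_neg_of_pos_of_neg ha (div_neg_of_neg_of_pos hnum hden)).le

/-- **The region enclosed by the hung sample of `e = ((x, y), a, K)` and the segment of its
feet** — the points of `ℍ` pulled back by `M⁻¹ = a · m_{x',y'}⁻¹` into the right domain of `K`,
i.e. `M(right domain of K) ∩ ℍ` — **is open** (`M⁻¹` is continuous on `ℍ`, its pole `y'` being
real, and the right domain is open). [folklore] -/
theorem isOpen_enclosed (e : ((ℝ × ℝ) × ℝ) × RestrictionConfig) :
    IsOpen (upperHalfPlaneSet ∩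
      (fun w ↦ (e.1.2 : ℂ) * excInv (min e.1.1.1 e.1.1.2) (max e.1.1.1 e.1.1.2) w) ⁻¹' e.2.rightDomain) := by
  refine ContinuousOn.isOpen_inter_preimage (continuousOn_mul_excInv _ _ _ fun h ↦ ?_)
    isOpen_upperHalfPlaneSet e.2.isOpen_rightDomain
  have : (0 : ℝ) < (((max e.1.1.1 e.1.1.2 : ℝ) : ℂ)).im := h
  simp at this

variable {Ω' : Type*} {X : Ω' → Set (((ℝ × ℝ) × ℝ) × RestrictionConfig)}

/-- **The region enclosed by a hung sample lies in the left-filled cloud** ([LSW] §2 p. 8: the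
left filling adds "the connected components of `ℍ̄ ∖ A` which do not intersect `[0, ∞)`"). If a
point `w` of the enclosed region of the cloud point `e = (q, K)` were in the component of some
`x₀ ≥ 0` in `ℍ̄ ∖ cloud`, that component — a connected set missing the hung sample `M(K)` and
its feet — would pull back under `M⁻¹ = a · m⁻¹` (continuous off the foot `y'`) to a connected
subset of `ℍ̄ ∖ cl K` containing `M⁻¹(w) ∈` right domain of `K`, hence lying in the right domain
(`RestrictionConfig.subset_rightDomain_of_isPreconnected`), yet also containing the nonpositive
real `M⁻¹(x₀)` (`RestrictionConfig.ofReal_notMem_rightDomain`).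
[cite: LawlerSchrammWerner2003Restriction, §2 p. 8 (Fillings); Lawler2005, §9.2 Prop. 9.13 (p. 220)] -/
theorem enclosed_subset_leftFilling {ω : Ω'} (hω : ω ∈ goodSet X)
    {e : ((ℝ × ℝ) × ℝ) × RestrictionConfig} (he : e ∈ X ω) :
    upperHalfPlaneSet ∩
        (fun w ↦ (e.1.2 : ℂ) * excInv (min e.1.1.1 e.1.1.2) (max e.1.1.1 e.1.1.2) w) ⁻¹' e.2.rightDomain ⊆
      leftFilling (cloudSet X ω) := by
  intro w hw
  obtain ⟨hwH, hwR⟩ := hw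
  have heg : e.1 ∈ goodParams := hω.1 e he
  obtain ⟨hxy, hy, ha, -⟩ := goodParams_lt heg
  set x' : ℝ := min e.1.1.1 e.1.1.2 with hx'
  set y' : ℝ := max e.1.1.1 e.1.1.2 with hy'
  set g : ℂ → ℂ := fun w ↦ (e.1.2 : ℂ) * excInv x' y' w with hg
  have hwR' : g w ∈ e.2.rightDomain := hwR
  refine mem_leftFilling_iff.2 ⟨le_of_lt (show 0 < w.im from hwH), fun x₀ hx₀ hwΓ ↦ ?_⟩
  set S : Set ℂ := {z : ℂ | 0 ≤ z.im} \ cloudSet X ω with hS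
  set Γ : Set ℂ := connectedComponentIn S (x₀ : ℂ) with hΓ
  have hΓS : Γ ⊆ S := connectedComponentIn_subset _ _
  have hx₀S : ((x₀ : ℝ) : ℂ) ∈ S := connectedComponentIn_nonempty_iff.1 ⟨w, hwΓ⟩
  have hx₀Γ : ((x₀ : ℝ) : ℂ) ∈ Γ := mem_connectedComponentIn hx₀S
  -- the feet lie in the cloud, hence off `Γ`
  have hx'C : ((x' : ℝ) : ℂ) ∈ cloudSet X ω := Or.inl (feet_mem_nonposAxis heg).1
  have hy'C : ((y' : ℝ) : ℂ) ∈ cloudSet X ω := Or.inl (feet_mem_nonposAxis heg).2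
  have hy'Γ : ((y' : ℝ) : ℂ) ∉ Γ := fun h ↦ (hΓS h).2 hy'C
  -- pull `Γ` back under `M⁻¹ = g = a · m⁻¹`
  have hcont : ContinuousOn g Γ := continuousOn_mul_excInv _ _ _ hy'Γ
  have hpre : IsPreconnected (g '' Γ) := isPreconnected_connectedComponentIn.image _ hcont
  have hsubcl : g '' Γ ⊆ {z : ℂ | 0 ≤ z.im} \ closure (e.2 : Set ℂ) := by
    rintro _ ⟨v, hv, rfl⟩
    have hvS : v ∈ S := hΓS hv
    have hvy : v ≠ ((y' : ℝ) : ℂ) := fun h ↦ hvS.2 (h ▸ hy'C)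
    refine ⟨mul_excInv_im_nonneg hxy ha hvS.1, fun hcl ↦ ?_⟩
    rw [e.2.closure_eq_union_zero] at hcl
    rcases hcl with hK | h0
    · -- `M⁻¹(v) ∈ K` puts `v = M(M⁻¹ v)` on the hung sample
      refine hvS.2 (Or.inr (mem_iUnion₂.2 ⟨e, he, ?_⟩))
      refine ⟨excInv x' y' v, ⟨g v, hK, ?_⟩, excMap_excInv hxy.ne hvy⟩
      show e.1.2⁻¹ • ((e.1.2 : ℂ) * excInv x' y' v) = excInv x' y' v
      rw [Complex.real_smul, ← mul_assoc, Complex.ofReal_inv,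
        inv_mul_cancel₀ (by exact_mod_cast ha.ne'), one_mul]
    · -- `M⁻¹(v) = 0` forces `v` to be a foot
      have h0' : (e.1.2 : ℂ) * excInv x' y' v = 0 := h0
      rcases mul_eq_zero.1 h0' with ha0 | hexc
      · exact ha.ne' (by exact_mod_cast ha0)
      · rw [excInv, div_eq_zero_iff] at hexc
        rcases hexc with h | h
        · exact hvS.2 ((sub_eq_zero.1 h) ▸ hx'C)
        · exact hvy (sub_eq_zero.1 h)
  -- `M⁻¹(w)` lies in the right domain of `K`, so the whole pulled-back set does
  have hsub : g '' Γ ⊆ e.2.rightDomain :=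
    e.2.subset_rightDomain_of_isPreconnected hpre hsubcl (mem_image_of_mem _ hwΓ) hwR'
  -- but `M⁻¹(x₀)` is a nonpositive real
  have hx₀R : (e.1.2 : ℂ) * excInv x' y' ((x₀ : ℝ) : ℂ) ∈ e.2.rightDomain := hsub (mem_image_of_mem _ hx₀Γ)
  rw [mul_excInv_ofReal] at hx₀R
  exact e.2.ofReal_notMem_rightDomain (mul_excInv_ofReal_nonpos (hxy.trans hy) hy ha hx₀) hx₀R

/-- **A cloud point `e = ((x, y), a, K)` with `a · m⁻¹(i)` in the right domain of `K` makes `i`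
an interior point of the left-filled cloud** (the enclosed region of `e` is an open subset of
the left filling containing `i`). [cite: Lawler2005, §9.2 Prop. 9.13 (p. 220)] -/
theorem I_mem_interior_cloudConfig_of_mem_rightDomain {ω : Ω'} (hω : ω ∈ goodSet X)
    {e : ((ℝ × ℝ) × ℝ) × RestrictionConfig} (he : e ∈ X ω)
    (hI : (e.1.2 : ℂ) * excInv (min e.1.1.1 e.1.1.2) (max e.1.1.1 e.1.1.2) Complex.I ∈ e.2.rightDomain) :
    Complex.I ∈ interior ((cloudConfig X ω : RightConfig) : Set ℂ) := by
  rw [coe_cloudConfig hω]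
  have hIH : (Complex.I : ℂ) ∈ upperHalfPlaneSet := by simp [upperHalfPlaneSet]
  exact interior_maximal (enclosed_subset_leftFilling hω he) (isOpen_enclosed e) ⟨hIH, hI⟩

end Enclosed

/-! ### `P'{i ∈ int K⁺} > 0` for the left-filled cloud of ANY `P_1` -/

section Positivity

variable {Ω' : Type*} [MeasurableSpace Ω'] {P' : Measure Ω'} {X : Ω' → Set (((ℝ × ℝ) × ℝ) × RestrictionConfig)}
  {β : ℝ} {P : Measure RestrictionConfig}

/-- **`P'{i ∈ int(left-filled cloud)} > 0`, for every two-sided restriction measure `P` of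
exponent `1`** ([Law05] proof of Cor. 9.11, positivity half, WITHOUT any hypothesis on the
samples of `P`): take a `+`-hull `A` containing a disc `B` of the open left quadrant
(`exists_isPlusHull_ball_subset`); `P{K ∩ A = ∅} = Φ'_A(0) > 0`
(`IsRestrictionMeasure.measure_avoid_pos`) and on this event `B ⊆ A ⊆` right domain of `K`
(`RestrictionConfig.subset_rightDomain_of_disjoint`); the parameters `((x, y), a)` with
`a · m⁻¹(i) ∈ B` form a nonempty open set `U` (`exists_goodParams_eq`) of positive parameter
measure; a cloud point in `U × {K ∩ A = ∅}` — probability `1 − exp(−Λ_β(U × {K ∩ A = ∅})) > 0` —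
makes `i` interior (`I_mem_interior_cloudConfig_of_mem_rightDomain`).
[cite: Lawler2005, Cor. 9.11 (proof, p. 219) with §9.2 Prop. 9.13 (p. 220)] -/
theorem measure_I_mem_interior_cloudConfig_pos (hP : IsRestrictionMeasure 1 P)
    (hβ : 0 < β) (hX : IsPoissonCloud (cloudIntensity β P) X P') :
    0 < P' {ω | Complex.I ∈ interior ((cloudConfig X ω : RightConfig) : Set ℂ)} := by
  haveI := hP.isProbabilityMeasure
  haveI := hX.isProbabilityMeasure
  obtain ⟨A, z₀, r₀, hA, hr₀, hz₀re, hz₀im, -, hballA⟩ := exists_isPlusHull_ball_subset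
  obtain ⟨qs, hqs, hζ⟩ := exists_goodParams_eq hz₀re hz₀im
  set ζ : (ℝ × ℝ) × ℝ → ℂ := fun q ↦ (q.2 : ℂ) * excInv (min q.1.1 q.1.2) (max q.1.1 q.1.2) Complex.I with hζdef
  set U : Set ((ℝ × ℝ) × ℝ) := goodParams ∩ ζ ⁻¹' ball z₀ r₀ with hU
  set V : Set RestrictionConfig := RestrictionConfig.avoid A with hV
  have hUo : IsOpen U := isOpen_goodParams.inter (continuous_hungPoint_I.isOpen_preimage _ isOpen_ball)
  have hUne : U.Nonempty := ⟨qs, hqs, by rw [mem_preimage, hζdef]; simp only; rw [hζ]; exact mem_ball_self hr₀⟩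
  have hUm : MeasurableSet U := hUo.measurableSet
  have hVm : MeasurableSet V := RestrictionConfig.measurableSet_avoid hA.1
  have hs : MeasurableSet (U ×ˢ V) := hUm.prod hVm
  have hVpos : 0 < P V := hP.measure_avoid_pos hA.1
  -- a cloud point in `U × V` makes `i` an interior point of the left-filled cloud
  have hkey : {ω | X ω ∩ (U ×ˢ V) ≠ ∅} ∩ goodSet X ⊆
      {ω | Complex.I ∈ interior ((cloudConfig X ω : RightConfig) : Set ℂ)} := by
    rintro ω ⟨hne, hω⟩
    obtain ⟨e, he, heU, heV⟩ := nonempty_iff_ne_empty.2 hne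
    refine I_mem_interior_cloudConfig_of_mem_rightDomain hω he ?_
    exact e.2.subset_rightDomain_of_disjoint hA (RestrictionConfig.mem_avoid.1 heV)
      (hballA (mem_preimage.1 heU.2))
  -- the probability of a cloud point in `U × V` is positive
  have hΛpos : 0 < cloudIntensity β P (U ×ˢ V) := by
    rw [cloudIntensity_prod]
    exact ENNReal.mul_pos (paramMeasure_pos_of_isOpen hβ hUo inter_subset_left hUne).ne' hVpos.ne'
  have hempty : P' {ω | X ω ∩ (U ×ˢ V) = ∅} < 1 := by
    by_cases htop : cloudIntensity β P (U ×ˢ V) = ∞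
    · have hae := hX.ae_encard_eq_top hs htop
      have h0 : P' {ω | X ω ∩ (U ×ˢ V) = ∅} = 0 := by
        rw [ae_iff] at hae
        refine measure_mono_null (fun ω hω ↦ ?_) hae
        simp only [mem_setOf_eq] at hω ⊢
        rw [hω]
        simp
      rw [h0]
      exact zero_lt_one
    · rw [hX.measure_inter_eq_empty hs htop]
      rw [← ENNReal.ofReal_one]
      refine (ENNReal.ofReal_lt_ofReal_iff zero_lt_one).2 ?_
      rw [Real.exp_lt_one_iff]
      exact neg_neg_of_pos (ENNReal.toReal_pos hΛpos.ne' htop)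
  have hpos : 0 < P' {ω | X ω ∩ (U ×ˢ V) ≠ ∅} := by
    have : {ω | X ω ∩ (U ×ˢ V) ≠ ∅} = {ω | X ω ∩ (U ×ˢ V) = ∅}ᶜ := rfl
    rw [this, prob_compl_eq_one_sub (hX.measurableSet_inter_eq_empty hs)]
    exact tsub_pos_iff_lt.2 hempty
  -- discard the null set of bad samples
  have hgood : P' (goodSet X)ᶜ = 0 := by
    have := ae_mem_goodSet hP hβ.le hX
    rwa [ae_iff] at this
  calc (0 : ℝ≥0∞) < P' {ω | X ω ∩ (U ×ˢ V) ≠ ∅} := hpos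
    _ = P' ({ω | X ω ∩ (U ×ˢ V) ≠ ∅} ∩ goodSet X) := (measure_inter_conull hgood).symm
    _ ≤ _ := measure_mono hkey

end Positivity

/-! ### Conclusions: every `P⁺_β` makes `i` interior with positive probability, given any `P_1` -/

section Final

/-- **For every `β > 0` some right-sided restriction measure of exponent `β` gives `{i ∈ int K}`
positive probability**, given ANY two-sided restriction measure of exponent `1` (the law of the
left-filled cloud, `isRightRestrictionMeasure_map_cloudConfig`, by Kingman's theorem
`exists_isPoissonCloud_holds`). [cite: Lawler2005, §9.2 Prop. 9.13 (p. 220) and Cor. 9.11 (proof, p. 219)] -/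
theorem exists_isRightRestrictionMeasure_intPos_of_exists_one
    (h1 : ∃ P : Measure RestrictionConfig, IsRestrictionMeasure 1 P) {β : ℝ} (hβ : 0 < β) :
    ∃ Q : Measure RightConfig, IsRightRestrictionMeasure β Q ∧
      Q {K : RightConfig | Complex.I ∈ interior (K : Set ℂ)} ≠ 0 := by
  obtain ⟨P, hP⟩ := h1
  haveI := hP.isProbabilityMeasure
  obtain ⟨Ω', _, P', X, hX⟩ := exists_isPoissonCloud_holds (cloudIntensity β P) measurableSet_diagonal_cloudSpace
    inferInstance (cloudIntensity_singleton β P)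
  haveI := hX.isProbabilityMeasure
  have hmeas := measurable_cloudConfig hX (P := P)
  refine ⟨P'.map (cloudConfig X), isRightRestrictionMeasure_map_cloudConfig hP hβ.le hX, ?_⟩
  rw [Measure.map_apply hmeas RightConfig.measurableSet_setOf_I_mem_interior]
  exact (measure_I_mem_interior_cloudConfig_pos hP hβ hX).ne'

/-- The same in the `ε`-form (`intPos`) consumed by the tree's one-sided reductions
(`IsRestrictionMeasure.eq_five_eighths_of_outer_simple_of_exists_of_intPos`, `pos_of_intPos`):
for every `ε > 0` some `P⁺_β`, `0 < β ≤ ε`, gives `{i ∈ int K}` positive probability.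
[cite: Lawler2005, Cor. 9.11 (proof, p. 219)] -/
theorem small_exponent_intPos_of_exists_one
    (h1 : ∃ P : Measure RestrictionConfig, IsRestrictionMeasure 1 P) :
    ∀ ε : ℝ, 0 < ε → ∃ (β : ℝ) (Q : Measure RightConfig), 0 < β ∧ β ≤ ε ∧
      IsRightRestrictionMeasure β Q ∧ Q {K : RightConfig | Complex.I ∈ interior (K : Set ℂ)} ≠ 0 := by
  intro ε hε
  obtain ⟨Q, hQ, hne⟩ := exists_isRightRestrictionMeasure_intPos_of_exists_one h1 hε
  exact ⟨ε, Q, hε, le_rfl, hQ, hne⟩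

/-- Hence also the positivity `P⁺_β{i ∉ K} < 1` for small `β` (`pos_of_intPos`), given any `P_1` —
the tree's `small_exponent_positivity` without its interior hypothesis.
[cite: Lawler2005, Cor. 9.11 (proof, p. 219)] -/
theorem small_exponent_positivity_of_exists_one
    (h1 : ∃ P : Measure RestrictionConfig, IsRestrictionMeasure 1 P) :
    ∀ ε : ℝ, 0 < ε → ∃ (β : ℝ) (Q : Measure RightConfig), 0 < β ∧ β ≤ ε ∧
      IsRightRestrictionMeasure β Q ∧ Q {K : RightConfig | Complex.I ∉ (K : Set ℂ)} < 1 :=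
  pos_of_intPos (small_exponent_intPos_of_exists_one h1)

end Final

end ExcursionCloud

/-- **Every `P⁺_β`, `β > 0`, gives `{i ∈ int K}` positive probability**, given any `P_1`
(uniqueness of `P⁺_β`, [LSW] §8.1 p. 31, `IsRightRestrictionMeasure.unique`).
[cite: Lawler2005, Cor. 9.11 (proof, p. 219); LawlerSchrammWerner2003Restriction, §8.1 p. 31] -/
theorem IsRightRestrictionMeasure.measure_I_mem_interior_ne_zero_of_exists_one
    (h1 : ∃ P : Measure RestrictionConfig, IsRestrictionMeasure 1 P) {β : ℝ} (hβ : 0 < β)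
    {Q : Measure RightConfig} (hQ : IsRightRestrictionMeasure β Q) :
    Q {K : RightConfig | Complex.I ∈ interior (K : Set ℂ)} ≠ 0 := by
  obtain ⟨Q', hQ', hne⟩ := ExcursionCloud.exists_isRightRestrictionMeasure_intPos_of_exists_one h1 hβ
  rwa [hQ.unique hQ']

/-! ### [LSW] Cor. 8.6, Prop. 8.1 and p. 5 result 2 from the existence of `P_1` alone -/

/-- **The Cor. 8.6 input `exists_isRightRestrictionMeasure_lt_five_eighths` from ANY `P_1`**
(existence of all `P⁺_β` by the hung cloud, positivity by the present file, `q(5/8) = 1/2` a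
theorem). [cite: Lawler2005, Cor. 9.11 (p. 219) with §9.2 Prop. 9.13 (p. 220)] -/
theorem exists_isRightRestrictionMeasure_lt_five_eighths_of_exists_one
    (h1 : ∃ P : Measure RestrictionConfig, IsRestrictionMeasure 1 P) :
    exists_isRightRestrictionMeasure_lt_five_eighths :=
  exists_isRightRestrictionMeasure_lt_five_eighths_of_exists_of_pos'
    (exists_isRightRestrictionMeasure_of_exists_restrictionMeasure_one h1)
    (ExcursionCloud.small_exponent_positivity_of_exists_one h1)

/-- **[LSW] Cor. 8.6 from ANY `P_1`** ([Law05] Cor. 9.11 as printed: no `P_α` for `α < 5/8`).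
[cite: Lawler2005, Cor. 9.11 (p. 219); LawlerSchrammWerner2003Restriction, Cor. 8.6 (pp. 37–38)] -/
theorem not_exists_isRestrictionMeasure_of_lt_five_eighths_of_exists_one
    (h1 : ∃ P : Measure RestrictionConfig, IsRestrictionMeasure 1 P) :
    not_exists_isRestrictionMeasure_of_lt_five_eighths :=
  not_exists_isRestrictionMeasure_of_lt_five_eighths_of_oneSided
    (exists_isRightRestrictionMeasure_lt_five_eighths_of_exists_one h1)

/-- **[LSW] p. 5 result 2, first sentence (outer reading), from ANY `P_1`** (the one-sided route
`IsRestrictionMeasure.eq_five_eighths_of_outer_simple_of_exists_of_intPos`).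
[cite: LawlerSchrammWerner2003Restriction, p. 5 result 2; Cor. 8.6 (pp. 37–38), §8.1–8.2] -/
theorem IsRestrictionMeasure.eq_five_eighths_of_outer_simple_of_exists_one
    (h1 : ∃ P : Measure RestrictionConfig, IsRestrictionMeasure 1 P) :
    IsRestrictionMeasure.eq_five_eighths_of_outer_simple :=
  IsRestrictionMeasure.eq_five_eighths_of_outer_simple_of_exists_of_intPos
    (exists_isRightRestrictionMeasure_of_exists_restrictionMeasure_one h1)
    (ExcursionCloud.small_exponent_intPos_of_exists_one h1)

/-- The almost-everywhere reading from ANY `P_1`. [cite: LawlerSchrammWerner2003Restriction, p. 5 result 2; Cor. 8.6 (pp. 37–38), §8.1–8.2] -/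
theorem IsRestrictionMeasure.eq_five_eighths_of_simple_of_exists_one
    (h1 : ∃ P : Measure RestrictionConfig, IsRestrictionMeasure 1 P) :
    IsRestrictionMeasure.eq_five_eighths_of_simple :=
  IsRestrictionMeasure.eq_five_eighths_of_simple_of_exists_of_intPos
    (exists_isRightRestrictionMeasure_of_exists_restrictionMeasure_one h1)
    (ExcursionCloud.small_exponent_intPos_of_exists_one h1)

/-- **`LawlerSchrammWerner2003` (chordal restriction + simple curves ⇒ SLE_{8/3}) from ANY `P_1`.**
[cite: LawlerSchrammWerner2003Restriction, p. 5 result 2; Prop. 3.3, Thm. 6.1, Cor. 8.6, §8.1–8.2] -/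
theorem LawlerSchrammWerner2003_of_exists_one
    (h1 : ∃ P : Measure RestrictionConfig, IsRestrictionMeasure 1 P) : LawlerSchrammWerner2003 :=
  LawlerSchrammWerner2003_of_exists_of_intPos
    (exists_isRightRestrictionMeasure_of_exists_restrictionMeasure_one h1)
    (ExcursionCloud.small_exponent_intPos_of_exists_one h1)

/-! ### [LSW] p. 5 result 1 is equivalent to its existence half above `5/8` -/

/-- **p. 5 result 1 from existence above `5/8` alone**: if `P_α` exists for every `α > 5/8`
then in particular `P_1` exists, which gives Cor. 8.6
(`not_exists_isRestrictionMeasure_of_lt_five_eighths_of_exists_one`); `α = 5/8` is Thm. 6.1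
(`exists_isRestrictionMeasure_iff_of_cor86_of_gt`).
[cite: LawlerSchrammWerner2003Restriction, p. 5 result 1; Thm. 7.3 (p. 29), Cor. 8.6 (p. 37)] -/
theorem exists_isRestrictionMeasure_iff_of_forall_gt
    (hgt : ∀ α : ℝ, 5 / 8 < α → ∃ P : Measure RestrictionConfig, IsRestrictionMeasure α P) :
    exists_isRestrictionMeasure_iff :=
  exists_isRestrictionMeasure_iff_of_cor86_of_gt
    (not_exists_isRestrictionMeasure_of_lt_five_eighths_of_exists_one (hgt 1 (by norm_num))) hgt

/-- **[LSW] p. 5 result 1 ⟺ `P_α` exists for every `α > 5/8`.** [cite: LawlerSchrammWerner2003Restriction, p. 5 result 1] -/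
theorem exists_isRestrictionMeasure_iff_iff_forall_gt :
    exists_isRestrictionMeasure_iff ↔
      ∀ α : ℝ, 5 / 8 < α → ∃ P : Measure RestrictionConfig, IsRestrictionMeasure α P :=
  ⟨fun h ↦ (exists_isRestrictionMeasure_iff_iff_gt.1 h).2, exists_isRestrictionMeasure_iff_of_forall_gt⟩

/-! ### … from the three EXISTENCE-ONLY §7 leaves -/

/-- **`P_1` exists, from the three existence-only §7 leaves** (Thm. 7.3 at `κ = 2`, `α₂ = 1`).
[cite: LawlerSchrammWerner2003Restriction, Thm. 7.3 (p. 29) and the sentence following its proof] -/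
theorem exists_isRestrictionMeasure_one_of_three_leaves
    (hμex : exists_isBrownianBubbleMeasure) (hcfg : SLEBubbles.ae_mem_restrictionConfigs)
    (h65 : SLEBubbles.lintegral_poissonAvoidance_eq_rpow) :
    ∃ P : Measure RestrictionConfig, IsRestrictionMeasure 1 P :=
  exists_isRestrictionMeasure_of_five_eighths_le_of_three_leaves hμex hcfg h65 (by norm_num)

/-- **[LSW] Prop. 8.1 from the three existence-only §7 leaves.** [cite: LawlerSchrammWerner2003Restriction, Prop. 8.1 (§8.2) with Thm. 7.3 (p. 29)] -/
theorem exists_isRightRestrictionMeasure_of_three_leaves'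
    (hμex : exists_isBrownianBubbleMeasure) (hcfg : SLEBubbles.ae_mem_restrictionConfigs)
    (h65 : SLEBubbles.lintegral_poissonAvoidance_eq_rpow) : exists_isRightRestrictionMeasure :=
  exists_isRightRestrictionMeasure_of_exists_restrictionMeasure_one
    (exists_isRestrictionMeasure_one_of_three_leaves hμex hcfg h65)

/-- **The Cor. 8.6 input from the three existence-only §7 leaves.** Its discharge is this theorem
applied to `exists_isBrownianBubbleMeasure_holds`, `SLEBubbles.ae_mem_restrictionConfigs_holds`,
`SLEBubbles.lintegral_poissonAvoidance_eq_rpow_holds`, once they exist.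
[cite: LawlerSchrammWerner2003Restriction, Cor. 8.6 (pp. 37–38) with Thm. 7.3 (p. 29); Lawler2005, Cor. 9.11] -/
theorem exists_isRightRestrictionMeasure_lt_five_eighths_of_three_leaves'
    (hμex : exists_isBrownianBubbleMeasure) (hcfg : SLEBubbles.ae_mem_restrictionConfigs)
    (h65 : SLEBubbles.lintegral_poissonAvoidance_eq_rpow) :
    exists_isRightRestrictionMeasure_lt_five_eighths :=
  exists_isRightRestrictionMeasure_lt_five_eighths_of_exists_one
    (exists_isRestrictionMeasure_one_of_three_leaves hμex hcfg h65)

/-- **[LSW] Cor. 8.6 from the three existence-only §7 leaves.** [cite: LawlerSchrammWerner2003Restriction, Cor. 8.6 (pp. 37–38) with Thm. 7.3 (p. 29)] -/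
theorem not_exists_isRestrictionMeasure_of_lt_five_eighths_of_three_leaves'
    (hμex : exists_isBrownianBubbleMeasure) (hcfg : SLEBubbles.ae_mem_restrictionConfigs)
    (h65 : SLEBubbles.lintegral_poissonAvoidance_eq_rpow) :
    not_exists_isRestrictionMeasure_of_lt_five_eighths :=
  not_exists_isRestrictionMeasure_of_lt_five_eighths_of_exists_one
    (exists_isRestrictionMeasure_one_of_three_leaves hμex hcfg h65)

/-- **[LSW] p. 5 result 1 (`exists_isRestrictionMeasure_iff`) from the three existence-only §7
leaves** (previously from the interior-point form of the bubble leaf,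
`exists_isRestrictionMeasure_iff_of_three_leaves`). Its discharge is this theorem applied to the
three `_holds` theorems, once they exist.
[cite: LawlerSchrammWerner2003Restriction, p. 5 result 1; Thm. 7.3 (p. 29), Cor. 8.6 (p. 37)] -/
theorem exists_isRestrictionMeasure_iff_of_three_leaves'
    (hμex : exists_isBrownianBubbleMeasure) (hcfg : SLEBubbles.ae_mem_restrictionConfigs)
    (h65 : SLEBubbles.lintegral_poissonAvoidance_eq_rpow) : exists_isRestrictionMeasure_iff :=
  exists_isRestrictionMeasure_iff_of_forall_gt fun _ hα ↦
    exists_isRestrictionMeasure_of_five_eighths_le_of_three_leaves hμex hcfg h65 hα.le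

/-- **[LSW] p. 5 result 2, first sentence (outer reading), from the three existence-only §7
leaves.** [cite: LawlerSchrammWerner2003Restriction, p. 5 result 2; Thm. 7.3 (p. 29), Cor. 8.6 (pp. 37–38)] -/
theorem IsRestrictionMeasure.eq_five_eighths_of_outer_simple_of_three_leaves'
    (hμex : exists_isBrownianBubbleMeasure) (hcfg : SLEBubbles.ae_mem_restrictionConfigs)
    (h65 : SLEBubbles.lintegral_poissonAvoidance_eq_rpow) :
    IsRestrictionMeasure.eq_five_eighths_of_outer_simple :=
  IsRestrictionMeasure.eq_five_eighths_of_outer_simple_of_exists_one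
    (exists_isRestrictionMeasure_one_of_three_leaves hμex hcfg h65)

/-- The almost-everywhere reading from the three existence-only §7 leaves.
[cite: LawlerSchrammWerner2003Restriction, p. 5 result 2; Thm. 7.3 (p. 29), Cor. 8.6 (pp. 37–38)] -/
theorem IsRestrictionMeasure.eq_five_eighths_of_simple_of_three_leaves'
    (hμex : exists_isBrownianBubbleMeasure) (hcfg : SLEBubbles.ae_mem_restrictionConfigs)
    (h65 : SLEBubbles.lintegral_poissonAvoidance_eq_rpow) :
    IsRestrictionMeasure.eq_five_eighths_of_simple :=
  IsRestrictionMeasure.eq_five_eighths_of_simple_of_exists_one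
    (exists_isRestrictionMeasure_one_of_three_leaves hμex hcfg h65)

/-- **`LawlerSchrammWerner2003` from the three existence-only §7 leaves** (a Brownian bubble
measure, `Ξ(κ) ∈ Ω` a.s., Theorem 6.5): its discharge is
`LawlerSchrammWerner2003_of_three_leaves' exists_isBrownianBubbleMeasure_holds
SLEBubbles.ae_mem_restrictionConfigs_holds SLEBubbles.lintegral_poissonAvoidance_eq_rpow_holds`,
once these exist. [cite: LawlerSchrammWerner2003Restriction, p. 5 result 2; Prop. 3.3, Thm. 6.1, Thm. 7.3, Cor. 8.6] -/
theorem LawlerSchrammWerner2003_of_three_leaves'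
    (hμex : exists_isBrownianBubbleMeasure) (hcfg : SLEBubbles.ae_mem_restrictionConfigs)
    (h65 : SLEBubbles.lintegral_poissonAvoidance_eq_rpow) : LawlerSchrammWerner2003 :=
  LawlerSchrammWerner2003_of_exists_one (exists_isRestrictionMeasure_one_of_three_leaves hμex hcfg h65)

end Literature.Probability.RandomPlanarGeometry

end
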